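import Summits.AtomisticToContinuum.Crystallization.Theorems.FrustratedLawDichotomyStrainedPatchHomConvexSegment

/-!
# Second-order segment expansion with an AFFINE curvature floor: the `κ/2 − λ/6` bound (real side of the G5′ value leaf, Lipschitz edition)

decomp-a2c hand-2 g40 — structural share for the crux `AperiodicFrustratedLawGap` (stmt-AtomisticToContinuum-27623; `(H) HomFloor`, hcp half),
DEF-FREE helper beneath hand-1 g41's G5′ value leaves `…HomValueT2Kit.valueLeafT2` (first edition: VALUE hulls of the Hessian, remainder `½·rad`)
and `…HomValueT2KitL.valueLeafT2L / valueLeafT2J` (second / third edition: LIPSCHITZ Hessian remainders along the segment from the box centre,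
remainder `(1/6)·Λ`), FINDING-hand-1-g41 §6 (I1) items (R1)/(R7).

THE ONE-VARIABLE FACT both editions consume.  Along the segment `s ↦ x_c + s·δ` put `g s := E(x_c + s·δ)`.  If the slope `g′` is continuous on
`[0,1]` and has a derivative `g″` at every interior parameter off a FINITE exceptional set (the potential of record `W₄₅` is piecewise `C²`/`C³`:
kinks of `W″` at the junction radii), and the curvature obeys the AFFINE floor `g″ s ≥ κ − λ·s` there (`κ = δᵀH^cδ` the centre Hessian form,
`λ = Λ[δ]³` a Lipschitz constant of the Hessian along the segment; `λ = 0`, `κ ↦ κ − r` is the value-hull class), then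

* `slope_affineFloor_of_deriv2_off` — `g′ t ≥ g′ 0 + κ·t − λ·t²/2` on `[0,1]` (`…HomConvexSegment.monotoneOn_of_deriv_nonneg_off` applied to
  `g′ − κ·id + λ·id²/2`);
* `tangentCubic_le` — that slope floor alone gives `g 1 ≥ g 0 + g′ 0 + κ/2 − λ/6` (the tree's `…HomConvexWell.tangentParabola_le` is `λ = 0`);
* `le_of_deriv2_affineFloor_off` — the two combined; `le_of_segment_deriv2_affineFloor` — the same along a segment `x₀ + t • v` of a real normed
  space (`f (x₀ + v) ≥ f x₀ + g′ 0 + κ/2 − λ/6`), and `le_of_segment_deriv2_floor` — the value-hull class (`g″ ≥ κ − r` ⟹ `κ/2 − r/2`).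
* `boxFloor_of_segment_expansions` — the LEAF ASSEMBLY over a set `B` of displacements: a certified centre value `V ≤ f x₀`, per-displacement slope
  `g′_δ 0 = a δ`, curvature data `(κ δ, λ δ)` with the segment hypotheses, a certified joint minimum `m ≤ a δ + κ δ/2` of the quadratic model on `B`
  and a penalty `λ δ/6 ≤ P` ⟹ `V + m − P ≤ f (x₀ + δ)` for every `δ ∈ B` — the shape of `LB = V₀ + boxMin − pen` in both kits.

NO definitions; 0 sorry; standard axioms; no instances / notation / `#eval`.  `--supports stmt-AtomisticToContinuum-27623`.
-/

noncomputable section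

namespace Summit.AtomisticToContinuum.Crystallization.Theorems.FrustratedLawDichotomyStrainedPatchHomConvexCubic

open Summit.AtomisticToContinuum.Crystallization.Theorems.FrustratedLawDichotomyStrainedPatchHomConvexSegment (monotoneOn_of_deriv_nonneg_off)

/-! ## §1. One variable -/

/-- ★ **TANGENT CUBIC** (1-D).  If `g` has derivative `g′` on `[0,1]` and `g′ t ≥ g′ 0 + κ·t − λ·t²/2` there, then `g 1 ≥ g 0 + g′ 0 + κ/2 − λ/6`.
[folklore: `h(t) = g t − g 0 − g′(0)t − κt²/2 + λt³/6` has `h′ ≥ 0`; `λ = 0` is `…HomConvexWell.tangentParabola_le`] -/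
theorem tangentCubic_le {g g' : ℝ → ℝ} {κ lam : ℝ} (hg : ∀ t ∈ Set.Icc (0 : ℝ) 1, HasDerivAt g (g' t) t)
    (hmono : ∀ t ∈ Set.Icc (0 : ℝ) 1, g' 0 + κ * t - lam * t ^ 2 / 2 ≤ g' t) : g 0 + g' 0 + κ / 2 - lam / 6 ≤ g 1 := by
  set h : ℝ → ℝ := fun t => g t - g 0 - g' 0 * t - κ * t ^ 2 / 2 + lam * t ^ 3 / 6 with hh
  have hder : ∀ t ∈ Set.Icc (0 : ℝ) 1, HasDerivAt h (g' t - g' 0 - κ * t + lam * t ^ 2 / 2) t := by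
    intro t ht
    have h1 := hg t ht
    have h2 : HasDerivAt (fun u : ℝ => g' 0 * u) (g' 0 * 1) t := (hasDerivAt_id t).const_mul (g' 0)
    have h3 : HasDerivAt (fun u : ℝ => κ * u ^ 2 / 2) (κ * ((2 : ℕ) * t ^ (2 - 1) * 1) / 2) t :=
      (((hasDerivAt_id t).pow 2).const_mul κ).div_const 2
    have h4 : HasDerivAt (fun u : ℝ => lam * u ^ 3 / 6) (lam * ((3 : ℕ) * t ^ (3 - 1) * 1) / 6) t :=
      (((hasDerivAt_id t).pow 3).const_mul lam).div_const 6
    have h5 := (((h1.sub_const (g 0)).sub h2).sub h3).add h4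
    refine h5.congr_deriv ?_
    push_cast
    ring
  have hcont : ContinuousOn h (Set.Icc 0 1) := fun t ht => (hder t ht).continuousAt.continuousWithinAt
  have hint : interior (Set.Icc (0 : ℝ) 1) = Set.Ioo 0 1 := interior_Icc
  have hdiff : DifferentiableOn ℝ h (interior (Set.Icc 0 1)) := by
    rw [hint]; exact fun t ht => (hder t (Set.Ioo_subset_Icc_self ht)).differentiableAt.differentiableWithinAt
  have hpos : ∀ t ∈ interior (Set.Icc (0 : ℝ) 1), 0 ≤ deriv h t := by
    rw [hint]
    intro t ht
    rw [(hder t (Set.Ioo_subset_Icc_self ht)).deriv]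
    linarith [hmono t (Set.Ioo_subset_Icc_self ht)]
  have hmvt := (convex_Icc (0 : ℝ) 1).mul_sub_le_image_sub_of_le_deriv hcont hdiff hpos 0 (Set.left_mem_Icc.2 zero_le_one) 1
    (Set.right_mem_Icc.2 zero_le_one) zero_le_one
  have h0 : h 0 = 0 := by simp [hh]
  have h1 : h 1 = g 1 - g 0 - g' 0 - κ / 2 + lam / 6 := by simp only [hh]; ring
  rw [h0, h1] at hmvt
  linarith

/-- ★ **SLOPE FLOOR FROM AN AFFINE CURVATURE FLOOR OFF A FINITE SET.**  `g′` continuous on `[0,1]`, `HasDerivAt g′ (g″ s) s` at every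
`s ∈ (0,1) ∖ X` (`X` finite) with `κ − λ·s ≤ g″ s` there ⟹ `g′ 0 + κ·t − λ·t²/2 ≤ g′ t` on `[0,1]`.
[folklore: `…HomConvexSegment.monotoneOn_of_deriv_nonneg_off` for `g′ − κ·id + λ·id²/2`] -/
theorem slope_affineFloor_of_deriv2_off {g' g'' : ℝ → ℝ} {κ lam : ℝ} (X : Finset ℝ) (hcont : ContinuousOn g' (Set.Icc (0 : ℝ) 1))
    (hder : ∀ s ∈ Set.Ioo (0 : ℝ) 1, s ∉ X → HasDerivAt g' (g'' s) s)
    (hfloor : ∀ s ∈ Set.Ioo (0 : ℝ) 1, s ∉ X → κ - lam * s ≤ g'' s) :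
    ∀ t ∈ Set.Icc (0 : ℝ) 1, g' 0 + κ * t - lam * t ^ 2 / 2 ≤ g' t := by
  have hφcont : ContinuousOn (fun t => g' t - κ * t + lam * t ^ 2 / 2) (Set.Icc (0 : ℝ) 1) :=
    (hcont.sub (by fun_prop)).add (by fun_prop)
  have hφder : ∀ s ∈ Set.Ioo (0 : ℝ) 1, s ∉ X →
      HasDerivAt (fun t => g' t - κ * t + lam * t ^ 2 / 2) (g'' s - κ + lam * s) s := by
    intro s hs hsX
    have h1 := hder s hs hsX
    have h2 : HasDerivAt (fun u : ℝ => κ * u) (κ * 1) s := (hasDerivAt_id s).const_mul κ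
    have h3 : HasDerivAt (fun u : ℝ => lam * u ^ 2 / 2) (lam * ((2 : ℕ) * s ^ (2 - 1) * 1) / 2) s :=
      (((hasDerivAt_id s).pow 2).const_mul lam).div_const 2
    refine ((h1.sub h2).add h3).congr_deriv ?_
    push_cast
    ring
  have hmono := monotoneOn_of_deriv_nonneg_off X hφcont hφder (fun s hs hsX => by linarith [hfloor s hs hsX])
  intro t ht
  have h := hmono 0 t le_rfl ht.2 ht.1
  simp only [mul_zero, sub_zero, ne_eq, OfNat.ofNat_ne_zero, not_false_eq_true, zero_pow, zero_div, add_zero] at h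
  linarith

/-- ★★ **THE `κ/2 − λ/6` BOUND** (1-D, piecewise `C²`): `g` with derivative `g′` on `[0,1]`, `g′` continuous there and differentiable off the finite
set `X` inside, curvature `g″ ≥ κ − λ·s` ⟹ `g 1 ≥ g 0 + g′ 0 + κ/2 − λ/6`. [folklore: the two lemmas above] -/
theorem le_of_deriv2_affineFloor_off {g g' g'' : ℝ → ℝ} {κ lam : ℝ} (X : Finset ℝ)
    (hg : ∀ t ∈ Set.Icc (0 : ℝ) 1, HasDerivAt g (g' t) t) (hcont : ContinuousOn g' (Set.Icc (0 : ℝ) 1))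
    (hder : ∀ s ∈ Set.Ioo (0 : ℝ) 1, s ∉ X → HasDerivAt g' (g'' s) s)
    (hfloor : ∀ s ∈ Set.Ioo (0 : ℝ) 1, s ∉ X → κ - lam * s ≤ g'' s) : g 0 + g' 0 + κ / 2 - lam / 6 ≤ g 1 :=
  tangentCubic_le hg (slope_affineFloor_of_deriv2_off X hcont hder hfloor)

/-- The value-hull class (`λ = 0`): curvature `g″ ≥ κ − r` off a finite set ⟹ `g 1 ≥ g 0 + g′ 0 + κ/2 − r/2`. [folklore] -/
theorem le_of_deriv2_floor_off {g g' g'' : ℝ → ℝ} {κ r : ℝ} (X : Finset ℝ)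
    (hg : ∀ t ∈ Set.Icc (0 : ℝ) 1, HasDerivAt g (g' t) t) (hcont : ContinuousOn g' (Set.Icc (0 : ℝ) 1))
    (hder : ∀ s ∈ Set.Ioo (0 : ℝ) 1, s ∉ X → HasDerivAt g' (g'' s) s)
    (hfloor : ∀ s ∈ Set.Ioo (0 : ℝ) 1, s ∉ X → κ - r ≤ g'' s) : g 0 + g' 0 + κ / 2 - r / 2 ≤ g 1 := by
  have h := le_of_deriv2_affineFloor_off (κ := κ - r) (lam := 0) X hg hcont hder (fun s hs hsX => by linarith [hfloor s hs hsX])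
  linarith

/-- **Upper companion** (for two-sided use, e.g. transporting a certified value DOWN to the centre): `g′ t ≤ g′ 0 + κ·t + λ·t²/2` on `[0,1]`
⟹ `g 1 ≤ g 0 + g′ 0 + κ/2 + λ/6`. [folklore: `tangentCubic_le` for `−g`] -/
theorem le_tangentCubic {g g' : ℝ → ℝ} {κ lam : ℝ} (hg : ∀ t ∈ Set.Icc (0 : ℝ) 1, HasDerivAt g (g' t) t)
    (hmono : ∀ t ∈ Set.Icc (0 : ℝ) 1, g' t ≤ g' 0 + κ * t + lam * t ^ 2 / 2) : g 1 ≤ g 0 + g' 0 + κ / 2 + lam / 6 := by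
  have h : -g 0 + -g' 0 + -κ / 2 - lam / 6 ≤ -g 1 :=
    tangentCubic_le (g := fun t => -g t) (g' := fun t => -g' t) (κ := -κ) (lam := lam) (fun t ht => (hg t ht).neg)
      (fun t ht => by
        have h1 := hmono t ht
        show -g' 0 + -κ * t - lam * t ^ 2 / 2 ≤ -g' t
        rw [show -g' 0 + -κ * t - lam * t ^ 2 / 2 = -(g' 0 + κ * t + lam * t ^ 2 / 2) by ring]
        linarith)
  linarith

/-! ## §2. Along a segment of a real normed space -/

variable {E : Type*} [NormedAddCommGroup E] [NormedSpace ℝ E]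

/-- ★★ **SEGMENT FORM.**  `g t := f (x₀ + t • v)` with derivative `g′` on `[0,1]`, `g′` continuous and differentiable off the finite set `X`
inside with `g″ s ≥ κ − λ·s` ⟹ `f (x₀ + v) ≥ f x₀ + g′ 0 + κ/2 − λ/6`.  (Second edition: `κ = δᵀH(x₀)δ`, `λ = Λ[δ]³` the Hessian's Lipschitz mass
along the segment.) [folklore] -/
theorem le_of_segment_deriv2_affineFloor {f : E → ℝ} {x₀ v : E} {g' g'' : ℝ → ℝ} {κ lam : ℝ} (X : Finset ℝ)
    (hg : ∀ t ∈ Set.Icc (0 : ℝ) 1, HasDerivAt (fun t : ℝ => f (x₀ + t • v)) (g' t) t) (hcont : ContinuousOn g' (Set.Icc (0 : ℝ) 1))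
    (hder : ∀ s ∈ Set.Ioo (0 : ℝ) 1, s ∉ X → HasDerivAt g' (g'' s) s)
    (hfloor : ∀ s ∈ Set.Ioo (0 : ℝ) 1, s ∉ X → κ - lam * s ≤ g'' s) : f x₀ + g' 0 + κ / 2 - lam / 6 ≤ f (x₀ + v) := by
  have h := le_of_deriv2_affineFloor_off (g := fun t : ℝ => f (x₀ + t • v)) X hg hcont hder hfloor
  simp only [zero_smul, add_zero, one_smul] at h
  exact h

/-- **Segment form, value-hull class**: `g″ ≥ κ − r` ⟹ `f (x₀ + v) ≥ f x₀ + g′ 0 + κ/2 − r/2`.  (First edition: `κ = δᵀH^cδ` the hull-centre form,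
`r = Σ rad|δ||δ|`.) [folklore] -/
theorem le_of_segment_deriv2_floor {f : E → ℝ} {x₀ v : E} {g' g'' : ℝ → ℝ} {κ r : ℝ} (X : Finset ℝ)
    (hg : ∀ t ∈ Set.Icc (0 : ℝ) 1, HasDerivAt (fun t : ℝ => f (x₀ + t • v)) (g' t) t) (hcont : ContinuousOn g' (Set.Icc (0 : ℝ) 1))
    (hder : ∀ s ∈ Set.Ioo (0 : ℝ) 1, s ∉ X → HasDerivAt g' (g'' s) s)
    (hfloor : ∀ s ∈ Set.Ioo (0 : ℝ) 1, s ∉ X → κ - r ≤ g'' s) : f x₀ + g' 0 + κ / 2 - r / 2 ≤ f (x₀ + v) := by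
  have h := le_of_deriv2_floor_off (g := fun t : ℝ => f (x₀ + t • v)) X hg hcont hder hfloor
  simp only [zero_smul, add_zero, one_smul] at h
  exact h

/-! ## §3. The leaf assembly: `LB = V₀ + boxMin − pen` -/

/-- ★★★ **BOX FLOOR FROM SEGMENT EXPANSIONS** (the shape of both value leaves).  For every displacement `δ ∈ B`: a slope function `g′ δ` of
`t ↦ f (x₀ + t • δ)` on `[0,1]` with `g′ δ 0 = a δ` (the centre gradient paired with `δ`), continuous, differentiable off the finite set `X δ` with the
affine curvature floor `κ δ − λ δ·s`; a certified centre value `V ≤ f x₀`; a certified joint minimum `m ≤ a δ + κ δ/2` of the quadratic model over `B`;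
and a penalty budget `λ δ/6 ≤ P` on `B` ⟹ `V + m − P ≤ f (x₀ + δ)` on `B`. [folklore: `le_of_segment_deriv2_affineFloor` + bookkeeping] -/
theorem boxFloor_of_segment_expansions {f : E → ℝ} {x₀ : E} {B : Set E} {a κ lam : E → ℝ} {g' g'' : E → ℝ → ℝ} (X : E → Finset ℝ)
    {V m P : ℝ} (hV : V ≤ f x₀)
    (hg : ∀ δ ∈ B, ∀ t ∈ Set.Icc (0 : ℝ) 1, HasDerivAt (fun t : ℝ => f (x₀ + t • δ)) (g' δ t) t)
    (h0 : ∀ δ ∈ B, g' δ 0 = a δ) (hcont : ∀ δ ∈ B, ContinuousOn (g' δ) (Set.Icc (0 : ℝ) 1))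
    (hder : ∀ δ ∈ B, ∀ s ∈ Set.Ioo (0 : ℝ) 1, s ∉ X δ → HasDerivAt (g' δ) (g'' δ s) s)
    (hfloor : ∀ δ ∈ B, ∀ s ∈ Set.Ioo (0 : ℝ) 1, s ∉ X δ → κ δ - lam δ * s ≤ g'' δ s)
    (hmin : ∀ δ ∈ B, m ≤ a δ + κ δ / 2) (hpen : ∀ δ ∈ B, lam δ / 6 ≤ P) : ∀ δ ∈ B, V + m - P ≤ f (x₀ + δ) := by
  intro δ hδ
  have h := le_of_segment_deriv2_affineFloor (X δ) (hg δ hδ) (hcont δ hδ) (hder δ hδ) (hfloor δ hδ)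
  rw [h0 δ hδ] at h
  linarith [hmin δ hδ, hpen δ hδ]

/-- **Box floor, value-hull class** (`λ = 0`, curvature `≥ κ δ − r δ`, penalty `r δ/2 ≤ P`): `V + m − P ≤ f (x₀ + δ)` on `B`. [folklore] -/
theorem boxFloor_of_segment_expansions_hull {f : E → ℝ} {x₀ : E} {B : Set E} {a κ r : E → ℝ} {g' g'' : E → ℝ → ℝ} (X : E → Finset ℝ)
    {V m P : ℝ} (hV : V ≤ f x₀)
    (hg : ∀ δ ∈ B, ∀ t ∈ Set.Icc (0 : ℝ) 1, HasDerivAt (fun t : ℝ => f (x₀ + t • δ)) (g' δ t) t)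
    (h0 : ∀ δ ∈ B, g' δ 0 = a δ) (hcont : ∀ δ ∈ B, ContinuousOn (g' δ) (Set.Icc (0 : ℝ) 1))
    (hder : ∀ δ ∈ B, ∀ s ∈ Set.Ioo (0 : ℝ) 1, s ∉ X δ → HasDerivAt (g' δ) (g'' δ s) s)
    (hfloor : ∀ δ ∈ B, ∀ s ∈ Set.Ioo (0 : ℝ) 1, s ∉ X δ → κ δ - r δ ≤ g'' δ s)
    (hmin : ∀ δ ∈ B, m ≤ a δ + κ δ / 2) (hpen : ∀ δ ∈ B, r δ / 2 ≤ P) : ∀ δ ∈ B, V + m - P ≤ f (x₀ + δ) := by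
  intro δ hδ
  have h := le_of_segment_deriv2_floor (X δ) (hg δ hδ) (hcont δ hδ) (hder δ hδ) (hfloor δ hδ)
  rw [h0 δ hδ] at h
  linarith [hmin δ hδ, hpen δ hδ]

omit [NormedSpace ℝ E] in
/-- **Level form** (what `semOKH`-type consumers read): under `boxFloor_of_segment_expansions`'s conclusion, a level `μ ≤ V + m − P` is a floor
`μ ≤ f (x₀ + δ)` on the whole box. [formal bookkeeping] -/
theorem levelFloor_of_boxFloor {f : E → ℝ} {x₀ : E} {B : Set E} {V m P μ : ℝ} (hbox : ∀ δ ∈ B, V + m - P ≤ f (x₀ + δ))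
    (hμ : μ ≤ V + m - P) : ∀ δ ∈ B, μ ≤ f (x₀ + δ) := fun δ hδ => hμ.trans (hbox δ hδ)

end Summit.AtomisticToContinuum.Crystallization.Theorems.FrustratedLawDichotomyStrainedPatchHomConvexCubic

end
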